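import Summits.Ventures.CertifiedManyBodySolver.Downfold.EmeryFermiSurfaceHoleLike
import Summits.Ventures.CertifiedManyBodySolver.Downfold.EmeryVanHoveLa214
import Summits.Ventures.CertifiedManyBodySolver.Downfold.EmeryScaleBoxLa214X007Pts
import Summits.Ventures.CertifiedManyBodySolver.Downfold.EmeryScaleBoxLa214DFTX007Pts
import Summits.Ventures.CertifiedManyBodySolver.Downfold.EmeryScaleBoxLa214SOLX007Pts
import HarnessLib

/-!
# THE σ FERMI-SURFACE TOPOLOGY OF THE COLUMN x = 0.07 (ν = 93/200; M14, the underdoped column x = 0.07) OF THE WORKED EXAMPLE: EVERY MEMBER OF BOX #18 — whole Δ_pd hull and both level tags — IS HOLE-LIKE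
# (INFL-3to1-B §B.95; kernel `EmeryFermiSurfaceHoleLike.holeLike_of_le_xVH` + the landed van Hove box certificate `EmeryVanHoveLa214.la214Box_xVH`)

Venture CertifiedManyBodySolver, cell `pub/hubbard-downfold` (stage S1), seat hubbard-downfold-mod-4 (technique B, g42); namespace `Summit.Ventures.CertifiedManyBodySolver.Downfold.Emery`. Everything PROVED (0 sorry; no new decide — `la214Box_xVH` (x_VH ≥ 9911/73728 = 0.1344 on the whole box, K = 384) + the landed K = 384 corner brackets of `EmeryScaleBox<Tag><X>Pts`).
WHY: x = 0.07 (1 − 2ν) is BELOW the σ van Hove hole doping of EVERY member of box #18 (x_VH ≥ 0.1344) ⇒ every member's Fermi surface at this filling is HOLE-LIKE (closed around (π, π);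
`0 < faceG(ε_F)`, `1 < xAxis(ε_F)`), uniformly over the whole box, so the fourth coordinate of the one-band image is the ZONE-FACE antinode weight (`EmeryBoxesLa214<Tag>FaceWeight<X>`).
WHAT THIS IS NOT: a statement about La₂₋ₓSrₓCuO₄ x = 0.07 (column M14 of box #18) — the typed box and its Δ_pd level tags are SCREENING-GRADE; `U = 0` one-body kinematics of the σ model; no U number; not a phase word. Generator: doping-g42/prod/gen_col.py.

Sources: three-band model [HybertsenSchluterChristensen1989, Eq. (1)]; [AndersenEtAl1995, §6]; [folklore] algebra.
-/

noncomputable section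

namespace Summit.Ventures.CertifiedManyBodySolver.Downfold.Emery

open Real Set

/-- **emeryBoxLa214v123 (whole Δ_pd hull [1.7, 4.0]): EVERY member is HOLE-LIKE at x = 0.07 (ν = 93/200)** — `0 < faceG(θ; ε_F) ∧ 1 < xAxis(θ; ε_F)`: the ε_F-contour reaches the zone face and the antibonding band stays
below ε_F on the whole Γ–X axis (x = 0.07 < 9911/73728 = 0.1344 ≤ x_VH(θ) by `la214Box_xVH`; E_h from `scalePt_La214X007_TP_br`; kernel `holeLike_of_le_xVH`). [folklore] -/
theorem la214Box_holeLike_x007 {Δ a b c : ℝ} (hΔ : Δ ∈ Icc ((17 : ℝ) / 10) (4 : ℝ)) (ha : a ∈ Icc ((129 : ℝ) / 100) ((38 : ℝ) / 25)) (hb : b ∈ Icc ((23 : ℝ) / 50) ((33 : ℝ) / 50)) (hc : c ∈ Icc ((3 : ℝ) / 25) ((3 : ℝ) / 20)) :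
    0 < faceG Δ a c (fermiEnergyOf Δ a b c ((93 : ℝ) / 200)) ∧ 1 < xAxis Δ a c (fermiEnergyOf Δ a b c ((93 : ℝ) / 200)) := by
  have hΔ0 : 0 < Δ := lt_of_lt_of_le (by norm_num) hΔ.1
  have ha0 : 0 < a := lt_of_lt_of_le (by norm_num) ha.1
  have hc0 : 0 ≤ c := le_trans (by norm_num) hc.1
  have hb0 : 0 ≤ b := le_trans (by norm_num) hb.1
  have hΔw : Δ ∈ Set.Icc (17 / 10 : ℝ) (4 : ℝ) := ⟨le_trans (by norm_num) hΔ.1, le_trans hΔ.2 (by norm_num)⟩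
  have hx := (la214Box_xVH hΔw (by simpa using ha) (by simpa using hb) (by simpa using hc)).2.2.2.1
  have hT := (fermiEnergyOf_of_pointBracketCheck scalePt_La214X007_TP_br (by norm_num) (by norm_num) (by norm_num) (ν := (93/200 : ℝ)) (by push_cast; exact ⟨le_rfl, le_rfl⟩)).2
  push_cast at hT
  have hbox := fermiEnergyOf_mem_Icc_of_mem_box' (ν := ((93 : ℝ) / 200)) (by norm_num) (by norm_num) (by norm_num) (by norm_num) hΔ ha hb hc (by norm_num) (by norm_num)
  have hν : ((93 : ℝ) / 200) = (93/200 : ℝ) := by norm_num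
  have hEh : fermiEnergyOf Δ a b c ((93 : ℝ) / 200) ≤ ((2917 : ℝ) / 1250) := by
    refine hbox.2.trans ?_
    rw [hν]; exact hT.2
  exact holeLike_of_le_xVH (X := (9911 / 73728 : ℝ)) (c₂ := ((3 : ℝ) / 20)) (a₁ := ((129 : ℝ) / 100)) hΔ0 ha0 hc0 hb0 (by norm_num) (by norm_num)
    hx (by norm_num) hEh hc.2 ha.1 (by norm_num) (by norm_num)

/-- **emeryBoxLa214v123 ∩ {Δ_pd ∈ [1.7, 2.91]} (DFT-level Δ tag): EVERY member is HOLE-LIKE at x = 0.07 (ν = 93/200)** — `0 < faceG(θ; ε_F) ∧ 1 < xAxis(θ; ε_F)`: the ε_F-contour reaches the zone face and the antibonding band stays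
below ε_F on the whole Γ–X axis (x = 0.07 < 9911/73728 = 0.1344 ≤ x_VH(θ) by `la214Box_xVH`; E_h from `scalePt_La214DFTX007_TP_br`; kernel `holeLike_of_le_xVH`). [folklore] -/
theorem la214DFTBox_holeLike_x007 {Δ a b c : ℝ} (hΔ : Δ ∈ Icc ((17 : ℝ) / 10) ((291 : ℝ) / 100)) (ha : a ∈ Icc ((129 : ℝ) / 100) ((38 : ℝ) / 25)) (hb : b ∈ Icc ((23 : ℝ) / 50) ((33 : ℝ) / 50)) (hc : c ∈ Icc ((3 : ℝ) / 25) ((3 : ℝ) / 20)) :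
    0 < faceG Δ a c (fermiEnergyOf Δ a b c ((93 : ℝ) / 200)) ∧ 1 < xAxis Δ a c (fermiEnergyOf Δ a b c ((93 : ℝ) / 200)) := by
  have hΔ0 : 0 < Δ := lt_of_lt_of_le (by norm_num) hΔ.1
  have ha0 : 0 < a := lt_of_lt_of_le (by norm_num) ha.1
  have hc0 : 0 ≤ c := le_trans (by norm_num) hc.1
  have hb0 : 0 ≤ b := le_trans (by norm_num) hb.1
  have hΔw : Δ ∈ Set.Icc (17 / 10 : ℝ) (4 : ℝ) := ⟨le_trans (by norm_num) hΔ.1, le_trans hΔ.2 (by norm_num)⟩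
  have hx := (la214Box_xVH hΔw (by simpa using ha) (by simpa using hb) (by simpa using hc)).2.2.2.1
  have hT := (fermiEnergyOf_of_pointBracketCheck scalePt_La214DFTX007_TP_br (by norm_num) (by norm_num) (by norm_num) (ν := (93/200 : ℝ)) (by push_cast; exact ⟨le_rfl, le_rfl⟩)).2
  push_cast at hT
  have hbox := fermiEnergyOf_mem_Icc_of_mem_box' (ν := ((93 : ℝ) / 200)) (by norm_num) (by norm_num) (by norm_num) (by norm_num) hΔ ha hb hc (by norm_num) (by norm_num)
  have hν : ((93 : ℝ) / 200) = (93/200 : ℝ) := by norm_num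
  have hEh : fermiEnergyOf Δ a b c ((93 : ℝ) / 200) ≤ ((2917 : ℝ) / 1250) := by
    refine hbox.2.trans ?_
    rw [hν]; exact hT.2
  exact holeLike_of_le_xVH (X := (9911 / 73728 : ℝ)) (c₂ := ((3 : ℝ) / 20)) (a₁ := ((129 : ℝ) / 100)) hΔ0 ha0 hc0 hb0 (by norm_num) (by norm_num)
    hx (by norm_num) hEh hc.2 ha.1 (by norm_num) (by norm_num)

/-- **emeryBoxLa214v123 ∩ {Δ_pd ∈ [3.24, 4.0]} (solver-level Δ tag): EVERY member is HOLE-LIKE at x = 0.07 (ν = 93/200)** — `0 < faceG(θ; ε_F) ∧ 1 < xAxis(θ; ε_F)`: the ε_F-contour reaches the zone face and the antibonding band stays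
below ε_F on the whole Γ–X axis (x = 0.07 < 9911/73728 = 0.1344 ≤ x_VH(θ) by `la214Box_xVH`; E_h from `scalePt_La214SOLX007_TP_br`; kernel `holeLike_of_le_xVH`). [folklore] -/
theorem la214SOLBox_holeLike_x007 {Δ a b c : ℝ} (hΔ : Δ ∈ Icc ((81 : ℝ) / 25) (4 : ℝ)) (ha : a ∈ Icc ((129 : ℝ) / 100) ((38 : ℝ) / 25)) (hb : b ∈ Icc ((23 : ℝ) / 50) ((33 : ℝ) / 50)) (hc : c ∈ Icc ((3 : ℝ) / 25) ((3 : ℝ) / 20)) :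
    0 < faceG Δ a c (fermiEnergyOf Δ a b c ((93 : ℝ) / 200)) ∧ 1 < xAxis Δ a c (fermiEnergyOf Δ a b c ((93 : ℝ) / 200)) := by
  have hΔ0 : 0 < Δ := lt_of_lt_of_le (by norm_num) hΔ.1
  have ha0 : 0 < a := lt_of_lt_of_le (by norm_num) ha.1
  have hc0 : 0 ≤ c := le_trans (by norm_num) hc.1
  have hb0 : 0 ≤ b := le_trans (by norm_num) hb.1
  have hΔw : Δ ∈ Set.Icc (17 / 10 : ℝ) (4 : ℝ) := ⟨le_trans (by norm_num) hΔ.1, le_trans hΔ.2 (by norm_num)⟩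
  have hx := (la214Box_xVH hΔw (by simpa using ha) (by simpa using hb) (by simpa using hc)).2.2.2.1
  have hT := (fermiEnergyOf_of_pointBracketCheck scalePt_La214SOLX007_TP_br (by norm_num) (by norm_num) (by norm_num) (ν := (93/200 : ℝ)) (by push_cast; exact ⟨le_rfl, le_rfl⟩)).2
  push_cast at hT
  have hbox := fermiEnergyOf_mem_Icc_of_mem_box' (ν := ((93 : ℝ) / 200)) (by norm_num) (by norm_num) (by norm_num) (by norm_num) hΔ ha hb hc (by norm_num) (by norm_num)
  have hν : ((93 : ℝ) / 200) = (93/200 : ℝ) := by norm_num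
  have hEh : fermiEnergyOf Δ a b c ((93 : ℝ) / 200) ≤ ((18241 : ℝ) / 10000) := by
    refine hbox.2.trans ?_
    rw [hν]; exact hT.2
  exact holeLike_of_le_xVH (X := (9911 / 73728 : ℝ)) (c₂ := ((3 : ℝ) / 20)) (a₁ := ((129 : ℝ) / 100)) hΔ0 ha0 hc0 hb0 (by norm_num) (by norm_num)
    hx (by norm_num) hEh hc.2 ha.1 (by norm_num) (by norm_num)

end Summit.Ventures.CertifiedManyBodySolver.Downfold.Emery
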